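import Literature.Barriers.RiemannHypothesis.TuranPartialSumsProofs
import Literature.NumberTheory.LFunctions.TuranLiouvilleCriterionSharp
import Mathlib.NumberTheory.Harmonic.Bounds
import HarnessLib

/-!
# Discharge of `Turan1948_criterion_sharp`: Turán's theorem in the `O(N^{−1/2})` form

Companion to `Literature/Barriers/RiemannHypothesis/TuranPartialSums.lean` (barrier
`TuranPartialSums`; the named fact `Turan1948_criterion_sharp : TuranHypothesisSharp → RiemannHypothesis`
is discharged here as `Turan1948_criterion_sharp_holds`), to `TuranPartialSumsBohr.lean` (Bohr's
equivalence for the sections: `exists_zetaPartialSum_zero_of_realTwistedSum_neg`), to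
`TuranPartialSumsProofs.lean` (the non-sharp `Turan1948_criterion_holds`; its Liouville-twist lemmas
`Turan1948.liouville_real_mul`, `Turan1948.abs_liouville_real_prime`,
`Turan1948.realTwistedSum_liouville_one` are reused) and to
`Literature/NumberTheory/LFunctions/TuranLiouvilleCriterionSharp.lean` (Landau's theorem:
`T(n) ≥ −K(1 + log n)²/√n` for large `n` implies RH). Everything in this file is PROVED; no named
fact is introduced.

The statement discharged is Turán's theorem as quoted by Beliakov–Matiyasevich (2014, §1): "Paul
Turán [Turan48] established that for proving the Riemann Hypothesis it would be sufficient to show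
that `sup{Re s : η_N(s) = 0} = 1 + O(N^{−1/2})`", i.e. Turán 1948, Thm. II (Ingham's review,
MR 10,286: "(IV) If, for `n > n₀`, `U_n(s)` omits in `σ > 1 + K n^{ϑ−1}` a real value `c_n` with
`−K₁n^{ϑ−1} ≤ c_n ≤ K₁n^{ϑ−1}`, then `ζ(s) ≠ 0` for `σ > ϑ` (`1/2 ≤ ϑ < 1`)", case `ϑ = 1/2`,
`c_n = 0`; Montgomery 1983 §1 quotes the variant Thm. III with `σ ≥ 1 + N^{−1/2+ε}`). The vendored
hypothesis `TuranHypothesisSharp` (every zero of `ζ_N`, `N ≥ N₀`, has `Re s ≤ 1 + C/√N`) is exactly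
"`U_N` omits `0` in `σ > 1 + C N^{−1/2}`"; the statement is faithful, and it is proved here as
printed (unconditionally — its hypothesis is known to fail by Montgomery 1983, which only makes the
implication easier, cf. `Turan1948_criterion_sharp_of_montgomery`).

## Proof (Turán 1948, proof of Thms. I–II, after Ingham's review and Apostol 1990 §8.13)

For `N ≥ max N₀ 1` put `σ_N = 1 + C⁺/√N` (`C⁺ = max C 0`).
1. Bohr's equivalence theorem and the intermediate value theorem (`TuranPartialSumsBohr.lean`): since
   `ζ_N` has no zero with `Re s > σ_N`, the real `λ`-twisted section is non-negative there, in
   particular `∑_{n ≤ N} λ(n) n^{−σ_N} ≥ 0` (`realTwistedSum_liouville_nonneg`).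
2. Moving down to `σ = 1` (`realTwistedSum_one_ge`): `0 ≤ n^{−1} − n^{−σ} ≤ (σ − 1) log n/n` and
   `∑_{n ≤ N} 1/n ≤ 1 + log N` give `T(N) = ∑_{n ≤ N} λ(n)/n ≥ −(C⁺/√N) log N (1 + log N)
   ≥ −C⁺(1 + log N)²/√N`.
3. Landau's theorem on `∫_1^∞ (T(x) + 2C⁺x^{−1/2}(1 + log x)²) x^{−(s+1)} dx` and
   `∑ λ(n) n^{−s} = ζ(2s)/ζ(s)` (`riemannHypothesis_of_liouvilleHarmonicSum_lower_bound`): RH.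

## References

* [Turan1948] P. Turán, *On some approximative Dirichlet-polynomials in the theory of the
  zeta-function of Riemann*, Danske Vid. Selsk. Mat.-Fys. Medd. 24 (1948) no. 17, Thms. I–IV (read
  through A. E. Ingham's review MR 10,286 = *Reviews in Number Theory 1940–72* M30-10, and through
  Montgomery 1983 §1).
* [BeliakovMatiyasevich2014] G. Beliakov, Yu. Matiyasevich, arXiv:1402.5295, §1 p. 2 (the quoted
  form of the criterion; read).
* [Montgomery1983] H. L. Montgomery, *Zeros of approximations to the zeta function*, Studies in Pure
  Mathematics (Turán memorial volume), 1983, §1–§2 (read).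
* [Apostol1990] T. M. Apostol, *Modular Functions and Dirichlet Series in Number Theory*, 2nd ed.,
  §8.13 Thm. 8.20 (Turán's theorem through Bohr's equivalence theorem).
-/

noncomputable section

namespace Literature.Barriers.RiemannHypothesis

open ArithmeticFunction Literature.NumberTheory.LFunctions

namespace Turan1948

/-! ## Turán's step on the sharp window, and the descent to `σ = 1` -/

/-- **Turán's step through Bohr's theorem, sharp window** (Apostol 1990, proof of Thm. 8.20, with
the half-plane `σ > σ₁` in place of `σ > 1`): if `ζ_N` (`N ≥ 1`) has no zero with `Re s > σ₁`, then
`∑_{n ≤ N} λ(n) n^{−σ₁} ≥ 0` (contrapositive of `exists_zetaPartialSum_zero_of_realTwistedSum_neg`).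
[cite: Apostol1990, §8.13, proof of Thm. 8.20] -/
theorem realTwistedSum_liouville_nonneg {N : ℕ} (hN : 1 ≤ N) {σ₁ : ℝ}
    (h : ∀ s : ℂ, zetaPartialSum N s = 0 → s.re ≤ σ₁) :
    0 ≤ realTwistedSum (fun k : ℕ ↦ (liouville k : ℝ)) N σ₁ := by
  by_contra hneg
  push Not at hneg
  obtain ⟨s, hs0, hsre, -⟩ := exists_zetaPartialSum_zero_of_realTwistedSum_neg
    liouville_real_mul abs_liouville_real_prime hN hneg 0
  have := h s hs0
  linarith

/-- Moving a real twisted sum from `σ ≥ 1` down to `1` costs at most `(σ − 1) log N (1 + log N)`: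
for `|χ| ≤ 1`, `∑ χ(n) n^{−1} ≥ ∑ χ(n) n^{−σ} − (σ − 1) log N · ∑_{n ≤ N} 1/n`, by
`0 ≤ n^{−1} − n^{−σ} = n^{−1}(1 − e^{−(σ−1) log n}) ≤ (σ − 1) log n / n` and `∑_{n ≤ N} 1/n ≤ 1 + log N`.
[folklore] -/
theorem realTwistedSum_one_ge {χ : ℕ → ℝ} (hχ : ∀ n : ℕ, |χ n| ≤ 1) {N : ℕ} (hN : 1 ≤ N)
    {σ : ℝ} (hσ : 1 ≤ σ) :
    realTwistedSum χ N σ - (σ - 1) * (Real.log N * (1 + Real.log N)) ≤ realTwistedSum χ N 1 := by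
  have hN1 : (1 : ℝ) ≤ N := by exact_mod_cast hN
  have hlogN : 0 ≤ Real.log N := Real.log_nonneg hN1
  -- the harmonic sum
  have hharm : ∑ n ∈ Finset.Icc 1 N, (n : ℝ)⁻¹ ≤ 1 + Real.log N := by
    have h := harmonic_le_one_add_log N
    simpa [harmonic_eq_sum_Icc, Rat.cast_sum, Rat.cast_inv, Rat.cast_natCast] using h
  -- termwise
  have hterm : ∀ n ∈ Finset.Icc 1 N,
      -((σ - 1) * Real.log N * (n : ℝ)⁻¹) ≤ χ n * (n : ℝ) ^ (-(1 : ℝ)) - χ n * (n : ℝ) ^ (-σ) := by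
    intro n hn
    have hn1 : (1 : ℝ) ≤ n := by exact_mod_cast (Finset.mem_Icc.1 hn).1
    have hn0 : (0 : ℝ) < n := by linarith
    have hnN : (n : ℝ) ≤ N := by exact_mod_cast (Finset.mem_Icc.1 hn).2
    set d : ℝ := (n : ℝ) ^ (-(1 : ℝ)) - (n : ℝ) ^ (-σ) with hd
    have hd0 : 0 ≤ d := by
      rw [hd, sub_nonneg]
      exact Real.rpow_le_rpow_of_exponent_le hn1 (by linarith)
    have hdle : d ≤ (σ - 1) * Real.log N * (n : ℝ)⁻¹ := by
      set a : ℝ := (σ - 1) * Real.log n with ha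
      have ha0 : 0 ≤ a := mul_nonneg (by linarith) (Real.log_nonneg hn1)
      have hexp : (n : ℝ) ^ (-σ) = (n : ℝ)⁻¹ * Real.exp (-a) := by
        rw [ha, show -((σ - 1) * Real.log n) = Real.log n * (-(σ - 1)) by ring,
          ← Real.rpow_def_of_pos hn0, ← Real.rpow_neg_one, ← Real.rpow_add hn0]
        congr 1
        ring
      have h1 : 1 - Real.exp (-a) ≤ a := by linarith [Real.add_one_le_exp (-a)]
      have hlogn : Real.log n ≤ Real.log N := Real.log_le_log hn0 hnN
      calc d = (n : ℝ)⁻¹ * (1 - Real.exp (-a)) := by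
            rw [hd, hexp, Real.rpow_neg_one]; ring
        _ ≤ (n : ℝ)⁻¹ * a := mul_le_mul_of_nonneg_left h1 (by positivity)
        _ ≤ (n : ℝ)⁻¹ * ((σ - 1) * Real.log N) := by
            refine mul_le_mul_of_nonneg_left ?_ (by positivity)
            rw [ha]
            exact mul_le_mul_of_nonneg_left hlogn (by linarith)
        _ = (σ - 1) * Real.log N * (n : ℝ)⁻¹ := by ring
    have hχn := hχ n
    have : -(|χ n| * d) ≤ χ n * d := by
      have := neg_abs_le (χ n * d)
      rwa [abs_mul, abs_of_nonneg hd0] at this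
    have h2 : |χ n| * d ≤ (σ - 1) * Real.log N * (n : ℝ)⁻¹ :=
      (mul_le_of_le_one_left hd0 hχn).trans hdle
    calc -((σ - 1) * Real.log N * (n : ℝ)⁻¹) ≤ -(|χ n| * d) := by linarith
      _ ≤ χ n * d := this
      _ = χ n * (n : ℝ) ^ (-(1 : ℝ)) - χ n * (n : ℝ) ^ (-σ) := by rw [hd]; ring
  have hsum := Finset.sum_le_sum hterm
  rw [Finset.sum_sub_distrib, Finset.sum_neg_distrib, ← Finset.mul_sum] at hsum
  have hcoef : 0 ≤ (σ - 1) * Real.log N := mul_nonneg (by linarith) hlogN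
  have h3 : (σ - 1) * Real.log N * ∑ n ∈ Finset.Icc 1 N, (n : ℝ)⁻¹ ≤
      (σ - 1) * (Real.log N * (1 + Real.log N)) := by
    rw [mul_assoc]
    exact mul_le_mul_of_nonneg_left (mul_le_mul_of_nonneg_left hharm hlogN) (by linarith)
  unfold realTwistedSum
  linarith

end Turan1948

open Turan1948 in
/-- **Discharge of `Turan1948_criterion_sharp`** (Turán 1948, Thm. II, in the form quoted by
Beliakov–Matiyasevich 2014 §1 and reviewed by Ingham, MR 10,286 (IV) with `ϑ = 1/2`, `c_n = 0`):
`TuranHypothesisSharp → RiemannHypothesis`. Proof: if every zero of `ζ_N` (`N ≥ N₀`) has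
`Re s ≤ σ_N = 1 + C/√N` (`C ≥ 0` w.l.o.g.), then by Bohr's equivalence and the intermediate value
theorem `∑_{n ≤ N} λ(n) n^{−σ_N} ≥ 0` (`Turan1948.realTwistedSum_liouville_nonneg`, from
`TuranPartialSumsBohr.lean`), hence `T(N) = ∑_{n ≤ N} λ(n)/n ≥ −(C/√N) log N (1 + log N)
≥ −C(1 + log N)²/√N` (`Turan1948.realTwistedSum_one_ge`), and Landau's theorem in the compensated form
(`riemannHypothesis_of_liouvilleHarmonicSum_lower_bound`, `TuranLiouvilleCriterionSharp.lean`) gives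
the Riemann hypothesis. (The hypothesis is in fact untenable — Montgomery 1983 — so the criterion is
also vacuously true given `montgomery1983_supZeroRe`, `Turan1948_criterion_sharp_of_montgomery`; the
present proof is Turán's unconditional implication.) [cite: BeliakovMatiyasevich2014, §1]
[cite: Turan1948, Thm. II] -/
theorem Turan1948_criterion_sharp_holds : Turan1948_criterion_sharp := by
  rintro ⟨C, N₀, hT⟩
  refine riemannHypothesis_of_liouvilleHarmonicSum_lower_bound ⟨max C 0, max N₀ 1, fun N hN ↦ ?_⟩
  set C' : ℝ := max C 0 with hC'
  have hC'0 : 0 ≤ C' := le_max_right _ _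
  have hN0 : N₀ ≤ N := le_trans (le_max_left _ _) hN
  have hN1 : 1 ≤ N := le_trans (le_max_right _ _) hN
  have hN1R : (1 : ℝ) ≤ N := by exact_mod_cast hN1
  set σN : ℝ := 1 + C' / Real.sqrt N with hσN
  have hdiv : 0 ≤ C' / Real.sqrt N := div_nonneg hC'0 (Real.sqrt_nonneg _)
  have hσN1 : 1 ≤ σN := by rw [hσN]; linarith
  -- every zero of `ζ_N` has real part `≤ σ_N`
  have hzeros : ∀ s : ℂ, zetaPartialSum N s = 0 → s.re ≤ σN := by
    intro s hs
    refine (hT N hN0 s hs).trans ?_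
    rw [hσN]
    gcongr
    exact le_max_left _ _
  -- Bohr + IVT: the real `λ`-twist is `≥ 0` at `σ_N`; move down to `σ = 1`
  have h0 := realTwistedSum_liouville_nonneg hN1 hzeros
  have h1 := realTwistedSum_one_ge (χ := fun k : ℕ ↦ (liouville k : ℝ))
    LiouvilleSum.abs_liouville_le_one hN1 hσN1
  rw [realTwistedSum_liouville_one] at h1
  have hσ : σN - 1 = C' / Real.sqrt N := by rw [hσN]; ring
  rw [hσ] at h1
  have hlog0 : 0 ≤ Real.log N := Real.log_nonneg hN1R
  have hl : Real.log N * (1 + Real.log N) ≤ (1 + Real.log N) ^ 2 := by nlinarith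
  have h2 : C' / Real.sqrt N * (Real.log N * (1 + Real.log N)) ≤
      C' * (1 + Real.log N) ^ 2 / Real.sqrt N := by
    calc C' / Real.sqrt N * (Real.log N * (1 + Real.log N))
        ≤ C' / Real.sqrt N * (1 + Real.log N) ^ 2 := mul_le_mul_of_nonneg_left hl hdiv
      _ = C' * (1 + Real.log N) ^ 2 / Real.sqrt N := by ring
  linarith

end Literature.Barriers.RiemannHypothesis

end
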